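import Mathlib
import Literature.Probability.RandomPlanarGeometry.RectangleConformalMap
import Literature.Probability.RandomPlanarGeometry.ChordalCurveFamily
import HarnessLib

/-!
# Translated rectangles as Jordan domains

Topic `Literature/Probability/RandomPlanarGeometry` (geometric input of the rigidity step of crux
stmt-CriticalPhenomena-0698, `Summits/CriticalPhenomena/CardyFormulaZ2`).

The translated rectangles `(rectDomain a b).map (z ↦ z + c i) = (-a, a) × (c - b, c + b)` as Jordan
domains (tree: `rectDomain`, `JordanDomain.map`, `similarity`): membership in their carrier,
closure and frontier, and the boundary parametrisation of their bottom side (parameters `θ / 4`)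
and top side (parameters `(2 + θ) / 4`), from `polygonLoop_apply_div`. Elementary.
-/

noncomputable section

open Set Filter Topology Complex Metric

namespace Literature.Probability.RandomPlanarGeometry

variable {a b : ℝ}

/-- The translation `z ↦ z + c i` as a similarity acts as stated. [folklore] -/
theorem similarity_one_apply (v z : ℂ) : similarity 1 one_ne_zero v z = z + v := by
  rw [similarity_apply, one_mul]

/-- **Carrier of the translated rectangle**: `w ∈ (-a, a) × (c - b, c + b)`. [folklore] -/
theorem mem_carrier_transRect (ha : 0 < a) (hb : 0 < b) (c : ℝ) {w : ℂ} :
    w ∈ ((rectDomain a b ha hb).map (similarity 1 one_ne_zero ((c : ℂ) * I))).carrier ↔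
      (-a < w.re ∧ w.re < a) ∧ (c - b < w.im ∧ w.im < c + b) := by
  rw [JordanDomain.carrier_map, rectDomain_carrier]
  constructor
  · rintro ⟨z, hz, rfl⟩
    rw [mem_symRect] at hz
    rw [similarity_one_apply]
    simp only [add_re, mul_re, ofReal_re, I_re, mul_zero, ofReal_im, I_im, mul_one, sub_self,
      add_zero, add_im, mul_im]
    exact ⟨hz.1, by linarith [hz.2.1], by linarith [hz.2.2]⟩
  · rintro ⟨h1, h2, h3⟩
    refine ⟨w - c * I, ?_, by rw [similarity_one_apply, sub_add_cancel]⟩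
    rw [mem_symRect]
    simp only [sub_re, mul_re, ofReal_re, I_re, mul_zero, ofReal_im, I_im, mul_one, sub_self,
      sub_zero, sub_im, mul_im, add_zero]
    exact ⟨h1, by linarith, by linarith⟩

/-- **Closure of the translated rectangle**: `[-a, a] × [c - b, c + b]`. [folklore] -/
theorem mem_closure_transRect (ha : 0 < a) (hb : 0 < b) (c : ℝ) {w : ℂ} :
    w ∈ closure ((rectDomain a b ha hb).map (similarity 1 one_ne_zero ((c : ℂ) * I))).carrier ↔
      (-a ≤ w.re ∧ w.re ≤ a) ∧ (c - b ≤ w.im ∧ w.im ≤ c + b) := by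
  rw [JordanDomain.carrier_map, rectDomain_carrier, ← Homeomorph.image_closure]
  constructor
  · rintro ⟨z, hz, rfl⟩
    rw [mem_closure_symRect ha hb] at hz
    rw [similarity_one_apply]
    simp only [add_re, mul_re, ofReal_re, I_re, mul_zero, ofReal_im, I_im, mul_one, sub_self,
      add_zero, add_im, mul_im]
    exact ⟨hz.1, by linarith [hz.2.1], by linarith [hz.2.2]⟩
  · rintro ⟨h1, h2, h3⟩
    refine ⟨w - c * I, ?_, by rw [similarity_one_apply, sub_add_cancel]⟩
    rw [mem_closure_symRect ha hb]
    simp only [sub_re, mul_re, ofReal_re, I_re, mul_zero, ofReal_im, I_im, mul_one, sub_self,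
      sub_zero, sub_im, mul_im, add_zero]
    exact ⟨h1, by linarith, by linarith⟩

/-- **Frontier of the translated rectangle**: the four closed sides. [folklore] -/
theorem mem_frontier_transRect (ha : 0 < a) (hb : 0 < b) (c : ℝ) {w : ℂ} :
    w ∈ frontier ((rectDomain a b ha hb).map (similarity 1 one_ne_zero ((c : ℂ) * I))).carrier ↔
      ((-a ≤ w.re ∧ w.re ≤ a) ∧ (w.im = c - b ∨ w.im = c + b)) ∨
        ((w.re = -a ∨ w.re = a) ∧ (c - b ≤ w.im ∧ w.im ≤ c + b)) := by
  rw [JordanDomain.carrier_map, rectDomain_carrier, ← Homeomorph.image_frontier]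
  constructor
  · rintro ⟨z, hz, rfl⟩
    rw [mem_frontier_symRect ha hb] at hz
    rw [similarity_one_apply]
    simp only [add_re, mul_re, ofReal_re, I_re, mul_zero, ofReal_im, I_im, mul_one, sub_self,
      add_zero, add_im, mul_im]
    rcases hz with ⟨h1, h2 | h2⟩ | ⟨h1, h2, h3⟩
    · exact Or.inl ⟨h1, Or.inl (by linarith)⟩
    · exact Or.inl ⟨h1, Or.inr (by linarith)⟩
    · exact Or.inr ⟨h1, by linarith, by linarith⟩
  · intro h
    refine ⟨w - c * I, ?_, by rw [similarity_one_apply, sub_add_cancel]⟩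
    rw [mem_frontier_symRect ha hb]
    simp only [sub_re, mul_re, ofReal_re, I_re, mul_zero, ofReal_im, I_im, mul_one, sub_self,
      sub_zero, sub_im, mul_im, add_zero]
    rcases h with ⟨h1, h2 | h2⟩ | ⟨h1, h2, h3⟩
    · exact Or.inl ⟨h1, Or.inl (by linarith)⟩
    · exact Or.inl ⟨h1, Or.inr (by linarith)⟩
    · exact Or.inr ⟨h1, by linarith, by linarith⟩

/-- The bottom side of `rectDomain a b`: parameters `θ / 4`, `θ ∈ [0, 1]`, run from `(-a, -b)`
to `(a, -b)`. [folklore] -/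
theorem rectDomain_boundary_bottom (ha : 0 < a) (hb : 0 < b) {θ : ℝ} (hθ : θ ∈ Icc (0 : ℝ) 1) :
    (rectDomain a b ha hb).boundary (θ / 4) = ⟨-a + 2 * a * θ, -b⟩ := by
  have h := polygonLoop_apply_div (l := rectVerts a b) (k := 0) (by simp) hθ
  simp only [CharP.cast_eq_zero, zero_add, length_rectVerts, Nat.cast_ofNat, Nat.reduceMod] at h
  change polygonLoop (rectVerts a b) (θ / 4) = _
  rw [h]
  simp only [rectVerts, List.getElem_cons_zero, List.getElem_cons_succ, AffineMap.lineMap_apply_module']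
  apply Complex.ext
  · simp; ring
  · simp

/-- The top side of `rectDomain a b`: parameters `(2 + θ) / 4`, `θ ∈ [0, 1]`, run from `(a, b)`
to `(-a, b)`. [folklore] -/
theorem rectDomain_boundary_top (ha : 0 < a) (hb : 0 < b) {θ : ℝ} (hθ : θ ∈ Icc (0 : ℝ) 1) :
    (rectDomain a b ha hb).boundary ((2 + θ) / 4) = ⟨a - 2 * a * θ, b⟩ := by
  have h := polygonLoop_apply_div (l := rectVerts a b) (k := 2) (by simp) hθ
  simp only [Nat.cast_ofNat, length_rectVerts, Nat.reduceAdd, Nat.reduceMod] at h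
  change polygonLoop (rectVerts a b) ((2 + θ) / 4) = _
  rw [h]
  simp only [rectVerts, List.getElem_cons_zero, List.getElem_cons_succ, AffineMap.lineMap_apply_module']
  apply Complex.ext
  · simp; ring
  · simp

/-- **Bottom side of the translated rectangle**: the boundary point of parameter `θ / 4` is
`(-a + 2aθ, c - b)`. [folklore] -/
theorem transRect_boundary_bottom (ha : 0 < a) (hb : 0 < b) (c : ℝ) {θ : ℝ} (hθ : θ ∈ Icc (0 : ℝ) 1) :
    ((rectDomain a b ha hb).map (similarity 1 one_ne_zero ((c : ℂ) * I))).boundary (θ / 4) =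
      ⟨-a + 2 * a * θ, c - b⟩ := by
  rw [JordanDomain.boundary_map, Function.comp_apply, rectDomain_boundary_bottom ha hb hθ,
    similarity_one_apply]
  apply Complex.ext <;> simp; ring

/-- **Top side of the translated rectangle**: the boundary point of parameter `(2 + θ) / 4` is
`(a - 2aθ, c + b)`. [folklore] -/
theorem transRect_boundary_top (ha : 0 < a) (hb : 0 < b) (c : ℝ) {θ : ℝ} (hθ : θ ∈ Icc (0 : ℝ) 1) :
    ((rectDomain a b ha hb).map (similarity 1 one_ne_zero ((c : ℂ) * I))).boundary ((2 + θ) / 4) =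
      ⟨a - 2 * a * θ, c + b⟩ := by
  rw [JordanDomain.boundary_map, Function.comp_apply, rectDomain_boundary_top ha hb hθ,
    similarity_one_apply]
  apply Complex.ext <;> simp; ring

end Literature.Probability.RandomPlanarGeometry
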